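import Literature.Combinatorics.Enumerative.MatrixForestTheoremInverse
import Literature.Probability.MarkovChains.GreenFunction
import Literature.Probability.MarkovChains.HarmonicExtension
import HarnessLib

/-!
# Kirchhoff's matrix forest theorem for a Markov chain, the Green tree formula and the harmonic
# tree formula (Pitman–Tang, Thm. 1.2, eqs. (1.7)–(1.9), Lemma 2.1)

HONEST FRAMING (as everywhere in this directory): finite state space, no path space — the Green
function, the hitting distribution and the mean hitting times enter through the first-step predicates
of the tree (`IsGreenSolution`, `IsHarmonicExtension`, `IsHittingTimeSolution`), which pin them down on an
irreducible chain.

Lane `lit-hodgefound`, seat p23, generation 47, row g47-#2 of the programme «Tree and forest formulas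
for finite Markov chains» [PitmanTang2018]; the combinatorial engine is row g47-#1,
`Combinatorics/Enumerative/MatrixForestTheoremInverse` (`forestWeight a R = w(R)`,
`forestWeightTo a R i j = w_{ij}(R)`, Lemma 2.2, the harmonic identity (2.9), `L(R)·W = w(R)·I`).

## Source, verbatim ([PitmanTang2018] J. Pitman, W. Tang, *Tree formulas, mean first passage times and
Kemeny's constant of a Markov chain*, Bernoulli 24 (2018), held text `paper:arxiv-1603.09017`, §1–§2)

**Theorem 1.2** (Kirchhoff's matrix forest theorem for directed graphs). «Let `R` be a subset of the
finite state space `S` of a Markov chain `(X_n)` with transition matrix **P**. Let `L := I − P` where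
`I` is the identity matrix on `S`, and let `L(R)` be the matrix indexed by `S ∖ R` obtained by removing
from `L` all the rows and columns indexed by `R`. Then `det L(R) = w(R) := Σ_{roots(f) = R} Π^P(f)`
(1.4) […]. Moreover, if `det L(R) > 0`, then `L(R)^{-1} = ( w_{ij}(R ∪ {j}) / w(R) )_{i,j ∈ S∖R}` (1.5).»
«the matrix in (1.5) is the Green function of the Markov chain with transition matrix **P** killed when
it hits `R`. From this, we derive the […] **Green tree formula**
`E_i Σ_{n=0}^{T_R − 1} 1(X_n = j) = L(R)^{-1}_{ij} = w_{ij}(R ∪ {j}) / w(R)` for `i, j ∈ S ∖ R` (1.7),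
where `T_R := inf{n ≥ 0; X_n ∈ R}` […]. Summing over `j ∈ S ∖ R` gives an expression for the mean
first passage time `E_i T_R = Σ_{j ∈ S∖R} w_{ij}(R ∪ {j}) / w(R)` (1.8). […] **Harmonic tree formula**
`P_i(X_{T_R} = j) = w_{ij}(R) / w(R)` for `i ∈ S` and `j ∈ R` (1.9).» §2: «for each `r ∈ R`, the
function `h_r(i) := P_i(X_{T_R} = r)` is the unique function `h` such that `h(i) = (Ph)(i)` for all
`i ∈ S ∖ R` with the boundary condition `h(i) = 1(i = r)` for `i ∈ R`.» **Lemma 2.1.** «Let **P** be a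
possibly reducible transition matrix indexed by a finite set `S`. For `R` a non-empty subset of `S`
[…] The following conditions are equivalent: (1) `w(R) > 0`. (2) There exists at least one forest **f**
of trees spanning `S` with `roots(f) = R` such that the tree product `Π^P(f) > 0` […]. (3) For every
`i ∈ S ∖ R` there exists a path **t** from `i` to some `r ∈ R` such that `Π^P(t) > 0`. […]
(5) `det L(R) ≠ 0`.»

## What is here (`P : Matrix X X ℝ`; weights `w(R) = forestWeight P R`, `w_{ij}(R) = forestWeightTo P R i j`)

* §1 `wLaplacian_eq_one_sub` — for unit row sums the tree's weighted Laplacian of the weights `P` IS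
  `I − P`; **Theorem 1.2**: `PitmanTang2018_thm_1_2_det` (**`det (I − P)(R) = w(R)`**, (1.4)) and
  `PitmanTang2018_thm_1_2_inv` (**`((I − P)(R))⁻¹_{ij} = w_{ij}(R ∪ {j}) / w(R)`** when `w(R) ≠ 0`, (1.5)).
* §2 **Lemma 2.1**: `0 ≤ w_{ij}(R) ≤ w(R)` for a non-negative kernel; (2) ⇒ (1)
  (`forestWeight_pos_of_isForestOn`), (1) ⇒ (2) (`exists_isForestOn_of_forestWeight_ne_zero`),
  (3) ⇒ (1) (`forestWeight_pos_of_paths`, a breadth-first forest of the directed graph `P > 0` towards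
  `R`), hence **`w(R) > 0` for an irreducible chain and `R ≠ ∅`** (`forestWeight_pos`); (1) ⟺ (5) is
  `det_wLaplacian_submatrix_ne_zero_iff` of row g47-#1.
* §3 **the Green tree formula (1.7)** for the tree's Green function of the chain stopped at `τ_z`
  (`R = {z}`): `G_{τ_z}(a, x) = w_{ax}({z, x}) / w({z})` (`IsGreenSolution.PitmanTang2018_green`;
  `w({z}) = Σ_z`, the tree sum), and **(1.8)**: `E_a(τ_z) = Σ_{x ≠ z} w_{ax}({z, x}) / w({z})` for the
  solution of the hitting-time equations (`IsHittingTimeSolution.PitmanTang2018_eq_1_8`).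
* §4 **the harmonic tree formula (1.9)**: the harmonic extension of `1_{r}` off `R` is
  `i ↦ w_{ir}(R) / w(R)` (`isHarmonicExtension_forestWeightTo` — it solves the Dirichlet problem whenever
  `w(R) ≠ 0`; `IsHarmonicExtension.PitmanTang2018_harmonic` — uniqueness on an irreducible chain), and
  `Σ_{r ∈ R} w_{ir}(R) / w(R) = 1`.

THEOREMS ONLY (no definition, no named fact, no instance); the probabilistic identifications
(`G = E Σ 1(X_n = j)`, `h_r(i) = P_i(X_{T_R} = r)`) are NOT claimed beyond the first-step predicates.

## References

* [PitmanTang2018] Thm. 1.2, eqs. (1.4)–(1.9), Lemma 2.1, §2 (first-step characterisations).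
* [LyonsPeres2016] §4.4 (Markov chain tree theorem; tree `MarkovChainTreeTheorem`, joined to these
  weights — `treeMeasure P j = w({j}) = Σ_j` — in the sequel row).
* [LevinPeres2017] §9.2 Prop. 9.1, §9.4 (9.16), §10.3 (10.13) (tree `HarmonicExtension`,
  `GreenFunction`, `RandomTargetLemma`).
* [ChebotarevAgaev2002] §3 Thm. 2 (tree `WeightedMatrixForestTheorem`).
-/

namespace Literature.Probability.MarkovChains

open Finset Matrix Function Literature.Combinatorics.Enumerative
  Literature.Combinatorics.SimpleGraph.WeightedMatrixForest

variable {X : Type*} [Fintype X] [DecidableEq X]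

/-! ### §1 `L = I − P` and Theorem 1.2 -/

section Kirchhoff

variable {P : Matrix X X ℝ}

/-- For unit row sums the weighted Laplacian `L = D − W` of the arc weights `p_{xy}` is `I − P`
(«Let `L := I − P`»; the diagonal weight `p_{xx}` never enters a forest). [cite: PitmanTang2018,
Thm. 1.2 («Let `L := I − P`»); §4 eq. (4.3) (`L^{G,c} = D^{G,c}(I − P)`)] -/
theorem wLaplacian_eq_one_sub (hP : ∀ x, ∑ y, P x y = 1) :
    wLaplacian (fun x y => P x y) = (1 : Matrix X X ℝ) - P := by
  ext u v
  by_cases h : u = v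
  · subst h
    rw [wLaplacian_apply_self, Matrix.sub_apply, Matrix.one_apply_eq]
    have := hP u
    rw [← add_sum_erase _ _ (mem_univ u)] at this
    linarith
  · rw [wLaplacian_apply_of_ne _ h, Matrix.sub_apply, Matrix.one_apply_ne h, zero_sub]

/-- **Theorem 1.2, (1.4)**: `det L(R) = w(R)` for `L = I − P`, `P` with unit row sums — the principal
minor of `I − P` off `R` is the total **P**-weight of the forests with root set `R`.
[cite: PitmanTang2018, Thm. 1.2 eq. (1.4)] -/
theorem PitmanTang2018_thm_1_2_det (hP : ∀ x, ∑ y, P x y = 1) (R : Finset X) :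
    (((1 : Matrix X X ℝ) - P).submatrix (Subtype.val : ↥(Rᶜ) → X) Subtype.val).det =
      forestWeight (fun x y => P x y) R := by
  rw [← wLaplacian_eq_one_sub hP, det_wLaplacian_submatrix_eq_forestWeight]

/-- **Theorem 1.2, (1.5)**: if `w(R) ≠ 0` (equivalently `det L(R) ≠ 0`) then
`(L(R)⁻¹)_{ij} = w_{ij}(R ∪ {j}) / w(R)` for `i, j ∉ R`. [cite: PitmanTang2018, Thm. 1.2 eq. (1.5)] -/
theorem PitmanTang2018_thm_1_2_inv (hP : ∀ x, ∑ y, P x y = 1) (R : Finset X)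
    (hR : forestWeight (fun x y => P x y) R ≠ 0) (i j : ↥(Rᶜ)) :
    (((1 : Matrix X X ℝ) - P).submatrix (Subtype.val : ↥(Rᶜ) → X) Subtype.val)⁻¹ i j =
      forestWeightTo (fun x y => P x y) (insert (j : X) R) i j / forestWeight (fun x y => P x y) R := by
  rw [← wLaplacian_eq_one_sub hP, inv_wLaplacian_submatrix_apply _ R hR]

/-- `det L(R) ≠ 0 ⟺ w(R) ≠ 0` for `L = I − P`. [cite: PitmanTang2018, Lemma 2.1 ((1) ⟺ (5))] -/
theorem PitmanTang2018_lemma_2_1_det (hP : ∀ x, ∑ y, P x y = 1) (R : Finset X) :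
    (((1 : Matrix X X ℝ) - P).submatrix (Subtype.val : ↥(Rᶜ) → X) Subtype.val).det ≠ 0 ↔
      forestWeight (fun x y => P x y) R ≠ 0 := by
  rw [PitmanTang2018_thm_1_2_det hP]

end Kirchhoff

/-! ### §2 Lemma 2.1: signs and positivity of the forest weights -/

section Positivity

variable {P : Matrix X X ℝ} {R : Finset X}

/-- `w(R) ≥ 0` for a non-negative kernel. [cite: PitmanTang2018, Lemma 2.1] -/
theorem forestWeight_nonneg (hP : ∀ x y, 0 ≤ P x y) (R : Finset X) :
    0 ≤ forestWeight (fun x y => P x y) R :=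
  sum_nonneg fun _ _ => prod_nonneg fun _ _ => hP _ _

/-- `w_{ij}(R) ≥ 0` for a non-negative kernel. [cite: PitmanTang2018, Lemma 2.1] -/
theorem forestWeightTo_nonneg (hP : ∀ x y, 0 ≤ P x y) (R : Finset X) (i j : X) :
    0 ≤ forestWeightTo (fun x y => P x y) R i j := by
  rw [forestWeightTo_eq_sum_ite]
  exact sum_nonneg fun _ _ => by split_ifs; exacts [prod_nonneg fun _ _ => hP _ _, le_rfl]

/-- `w_{ij}(R) ≤ w(R)` for a non-negative kernel (a sub-sum). [cite: PitmanTang2018, eq. (1.9)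
(`P_i(X_{T_R} = j) = w_{ij}(R)/w(R)` is a probability)] -/
theorem forestWeightTo_le_forestWeight (hP : ∀ x y, 0 ≤ P x y) (R : Finset X) (i j : X) :
    forestWeightTo (fun x y => P x y) R i j ≤ forestWeight (fun x y => P x y) R := by
  rw [forestWeightTo_eq_sum_ite, forestWeight]
  exact sum_le_sum fun _ _ => by
    split_ifs
    exacts [le_rfl, prod_nonneg fun _ _ => hP _ _]

/-- **Lemma 2.1, (2) ⇒ (1)**: one forest rooted at `R` with all its arc weights positive makes
`w(R) > 0`. [cite: PitmanTang2018, Lemma 2.1 ((2) ⇒ (1))] -/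
theorem forestWeight_pos_of_isForestOn (hP : ∀ x y, 0 ≤ P x y) {τ : X → X}
    (hτ : IsForestOn (univ : Finset X) R τ) (hpos : ∀ v, v ∉ R → 0 < P v (τ v)) :
    0 < forestWeight (fun x y => P x y) R := by
  rw [forestWeight]
  calc (0 : ℝ) < ∏ v ∈ Rᶜ, P v (τ v) := prod_pos fun v hv => hpos v (mem_compl.1 hv)
    _ ≤ ∑ τ ∈ forests (univ : Finset X) R, ∏ v ∈ Rᶜ, P v (τ v) :=
        single_le_sum (f := fun τ : X → X => ∏ v ∈ Rᶜ, P v (τ v))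
          (fun _ _ => prod_nonneg fun _ _ => hP _ _) (mem_forests.2 hτ)

/-- **Lemma 2.1, (1) ⇒ (2)**: if `w(R) ≠ 0` some forest rooted at `R` has all its arc weights
non-zero. [cite: PitmanTang2018, Lemma 2.1 ((1) ⇒ (2))] -/
theorem exists_isForestOn_of_forestWeight_ne_zero {S : Type*} [CommRing S] {a : X → X → S}
    (h : forestWeight a R ≠ 0) :
    ∃ τ : X → X, IsForestOn (univ : Finset X) R τ ∧ ∀ v, v ∉ R → a v (τ v) ≠ 0 := by
  obtain ⟨τ, hτ, hne⟩ := exists_ne_zero_of_sum_ne_zero h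
  refine ⟨τ, mem_forests.1 hτ, fun v hv h0 => hne (prod_eq_zero (mem_compl.2 hv) h0)⟩

/-- **Lemma 2.1, (3) ⇒ (1)**: if from every state some state of `R` can be reached along arcs of
positive probability, then `w(R) > 0` — a breadth-first forest of the directed graph `{p_{xy} > 0}`
towards `R` has positive weight («recursively selecting a path until it either joins an existing path
leading to some `r ∈ R`, or reaches a different `r′ ∈ R`»). [cite: PitmanTang2018, Lemma 2.1
((3) ⇒ (2) ⇒ (1))] -/
theorem forestWeight_pos_of_paths (hP : ∀ x y, 0 ≤ P x y)
    (hpath : ∀ i, ∃ n : ℕ, ∃ r ∈ R, 0 < (P ^ n) i r) :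
    0 < forestWeight (fun x y => P x y) R := by
  classical
  -- graph distance to `R`
  let d : X → ℕ := fun v => Nat.find (hpath v)
  have hd : ∀ v, ∃ r ∈ R, 0 < (P ^ d v) v r := fun v => Nat.find_spec (hpath v)
  have hdmin : ∀ v n, n < d v → ¬ ∃ r ∈ R, 0 < (P ^ n) v r := fun v n hn => Nat.find_min (hpath v) hn
  have hd0 : ∀ v, d v = 0 ↔ v ∈ R := by
    intro v
    constructor
    · intro h
      obtain ⟨r, hr, hvr⟩ := hd v
      rw [h, pow_zero] at hvr
      by_contra hvR
      have hne : v ≠ r := fun h' => hvR (h' ▸ hr)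
      rw [Matrix.one_apply_ne hne] at hvr
      exact lt_irrefl _ hvr
    · intro hv
      have : ∃ r ∈ R, 0 < (P ^ 0) v r := ⟨v, hv, by rw [pow_zero, Matrix.one_apply_eq]; exact one_pos⟩
      exact Nat.eq_zero_of_le_zero (Nat.find_min' (hpath v) this)
  -- a step towards `R`: from `v ∉ R` some `w` with `P(v,w) > 0` and `d w < d v`
  have hstep : ∀ v, v ∉ R → ∃ w, 0 < P v w ∧ d w < d v := by
    intro v hv
    have hpos : 0 < d v := Nat.pos_of_ne_zero fun h => hv ((hd0 v).1 h)
    obtain ⟨n, hn⟩ : ∃ n, d v = n + 1 := ⟨d v - 1, by omega⟩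
    obtain ⟨r, hr, h1⟩ := hd v
    rw [hn, pow_succ', Matrix.mul_apply] at h1
    obtain ⟨w, -, hw⟩ : ∃ w ∈ (univ : Finset X), 0 < P v w * (P ^ n) w r := by
      by_contra hcon
      push Not at hcon
      exact absurd (sum_nonpos hcon) (not_le.2 h1)
    have hPvw : 0 ≤ P v w := hP v w
    have hw1 : 0 < P v w := lt_of_le_of_ne hPvw fun h0 => by simp [← h0] at hw
    have hw2 : 0 < (P ^ n) w r := by
      rcases lt_trichotomy 0 ((P ^ n) w r) with h | h | h
      · exact h
      · simp [← h] at hw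
      · exact absurd hw (not_lt.2 (mul_nonpos_of_nonneg_of_nonpos hPvw h.le))
    refine ⟨w, hw1, ?_⟩
    have : d w ≤ n := Nat.find_min' (hpath w) ⟨r, hr, hw2⟩
    omega
  -- the breadth-first parent map
  let g : X → X := fun v => if hv : v ∈ R then v else (hstep v hv).choose
  have hg_R : ∀ v ∈ R, g v = v := fun v hv => by simp [g, hv]
  have hg_ne : ∀ v (hv : v ∉ R), 0 < P v (g v) ∧ d (g v) < d v := by
    intro v hv
    simp only [g, dif_neg hv]
    exact (hstep v hv).choose_spec
  have hg_reach : ∀ n v, d v ≤ n → ∃ m : ℕ, g^[m] v ∈ R := by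
    intro n
    induction n with
    | zero =>
      intro v hv
      exact ⟨0, (hd0 v).1 (Nat.le_zero.1 hv)⟩
    | succ n ih =>
      intro v hv
      by_cases hvR : v ∈ R
      · exact ⟨0, hvR⟩
      · obtain ⟨m, hm⟩ := ih (g v) (by have := (hg_ne v hvR).2; omega)
        exact ⟨m + 1, by rw [iterate_succ_apply]; exact hm⟩
  have hforest : IsForestOn (univ : Finset X) R g :=
    isForestOn_univ_iff.2 ⟨hg_R, fun v => hg_reach (d v) v le_rfl⟩
  exact forestWeight_pos_of_isForestOn hP hforest fun v hv => (hg_ne v hv).1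

/-- **`w(R) > 0` for an irreducible chain and a nonempty root set** («Assume that **P** is irreducible
or equivalently, that `Σ_j > 0` for every `j ∈ S`»; here for every `R ≠ ∅`). [cite: PitmanTang2018,
Lemma 2.1; Thm. 1.1 («irreducible or equivalently `Σ_j > 0`»)] -/
theorem forestWeight_pos (hP : IsRowStochastic P) (hirr : IsIrreducible P) (hR : R.Nonempty) :
    0 < forestWeight (fun x y => P x y) R := by
  obtain ⟨r, hr⟩ := hR
  exact forestWeight_pos_of_paths hP.1 fun i => by
    obtain ⟨n, hn⟩ := hirr i r
    exact ⟨n, r, hr, hn⟩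

end Positivity

/-! ### §3 The Green tree formula (1.7) and the mean first passage time to a state (1.8) -/

section Green

variable {P : Matrix X X ℝ} {z : X}

/-- The candidate `G(a, x) = w_{ax}({z, x}) / Σ_z` (`x ≠ z`; `0` for `x = z`) solves the first-step
system of the Green function of the chain stopped at `τ_z`, for ANY kernel with unit row sums and
`Σ_z ≠ 0`: the diagonal equations are Lemma 2.2, the off-diagonal ones the harmonic identity (2.9).
[cite: PitmanTang2018, eq. (1.7) with §2 («the Green tree formula (1.7) and the harmonic tree formula
(1.9) […] can be proved by purely combinatorial arguments»), Lemma 2.2, eq. (2.9)] -/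
theorem isGreenSolution_forestWeightTo (hP : ∀ x, ∑ y, P x y = 1)
    (hz : forestWeight (fun x y => P x y) {z} ≠ 0) :
    IsGreenSolution P z fun a x => if x = z then 0 else
      forestWeightTo (fun x y => P x y) (insert x {z}) a x / forestWeight (fun x y => P x y) {z} := by
  have hzmem : ∀ x, z ∈ insert x ({z} : Finset X) := fun x => mem_insert_of_mem (mem_singleton_self z)
  refine ⟨fun x => ?_, fun a x ha => ?_⟩
  · -- `G(z, ·) = 0`: `z` is a root of `{x, z}` other than `x`
    show (if x = z then (0 : ℝ) else forestWeightTo (fun x y => P x y) (insert x {z}) z x /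
      forestWeight (fun x y => P x y) {z}) = 0
    split_ifs with hxz
    · rfl
    · rw [forestWeightTo_of_mem_roots _ _ (hzmem x), if_neg hxz, zero_div]
  · show (if x = z then (0 : ℝ) else forestWeightTo (fun x y => P x y) (insert x {z}) a x /
        forestWeight (fun x y => P x y) {z}) =
      (if a = x then 1 else 0) + ∑ y, P a y * (if x = z then (0 : ℝ) else
        forestWeightTo (fun x y => P x y) (insert x {z}) y x / forestWeight (fun x y => P x y) {z})
    by_cases hxz : x = z
    · subst hxz
      simp [ha]
    simp only [hxz, if_false]
    have hxR : x ∉ ({z} : Finset X) := fun h => hxz (mem_singleton.1 h)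
    rw [div_eq_iff hz, add_mul, sum_mul]
    simp_rw [mul_div_assoc', div_mul_cancel₀ _ hz]
    by_cases hax : a = x
    · -- diagonal: Lemma 2.2 with `R = {z}`, `j = x`
      subst hax
      rw [if_pos rfl, one_mul, forestWeightTo_self,
        forestWeight_insert_of_rowsum (fun x y => P x y) hxR (hP a), compl_singleton,
        ← add_sum_erase _ (fun y => P a y * forestWeightTo (fun x y => P x y) (insert a {z}) y a)
          (mem_univ z), forestWeightTo_of_mem_roots _ _ (hzmem a), if_neg ha, mul_zero, zero_add]
    · -- off the diagonal: the harmonic identity (2.9) with root set `{x, z}`, root `x`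
      have haR : a ∉ insert x ({z} : Finset X) := by simp [hax, ha]
      have hkey := outWeight_mul_forestWeightTo (fun x y => P x y) haR (mem_insert_self x {z})
      rw [if_neg hax, zero_mul, zero_add]
      calc forestWeightTo (fun x y => P x y) (insert x {z}) a x
          = (∑ k, P a k) * forestWeightTo (fun x y => P x y) (insert x {z}) a x := by
            rw [hP a, one_mul]
        _ = P a a * forestWeightTo (fun x y => P x y) (insert x {z}) a x +
              ∑ k ∈ univ.erase a, P a k * forestWeightTo (fun x y => P x y) (insert x {z}) k x := by
            rw [← add_sum_erase _ _ (mem_univ a), add_mul]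
            exact congrArg _ hkey
        _ = ∑ y, P a y * forestWeightTo (fun x y => P x y) (insert x {z}) y x :=
            add_sum_erase _ (fun y => P a y * forestWeightTo (fun x y => P x y) (insert x {z}) y x)
              (mem_univ a)

/-- **The Green tree formula (1.7)** for the chain stopped at `τ_z` (`R = {z}`): on an irreducible chain
the Green function `G_{τ_z}(a, x)` — the solution of the tree's first-step system `IsGreenSolution` —
is `w_{ax}({z, x}) / w({z})` (`w({z}) = Σ_z`) for every `x ≠ z` (and every `a`). [cite: PitmanTang2018, eq. (1.7)
(Green tree formula), with `R = {z}` as in §3 eq. (3.5) («by setting `R = {k}` in the Green tree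
formula»)] [cite: LevinPeres2017, §9.4 eq. (9.16) (the Green function `G_{τ_z}`)] -/
theorem IsGreenSolution.PitmanTang2018_green (hP : IsRowStochastic P) (hirr : IsIrreducible P)
    {G : X → X → ℝ} (hG : IsGreenSolution P z G) (a : X) {x : X} (hx : x ≠ z) :
    G a x = forestWeightTo (fun x y => P x y) {x, z} a x / forestWeight (fun x y => P x y) {z} := by
  have hz : forestWeight (fun x y => P x y) {z} ≠ 0 :=
    (forestWeight_pos hP hirr (singleton_nonempty z)).ne'
  rw [hG.unique hP hirr (isGreenSolution_forestWeightTo hP.2 hz)]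
  simp only [hx, if_false]

/-- **(1.8) for one target**: the mean hitting time of `z` from `a` — the tree's solution `h(a, z)` of
the first-step equations — is `E_a(τ_z) = Σ_{x ≠ z} w_{ax}({z, x}) / w({z})` (the row sum of the Green
function, eq. (10.13) of the tree's `GreenFunction`). [cite: PitmanTang2018, eq. (1.8) with `R = {z}`;
§3, proof of Thm. 1.3 («By setting `R = {j}` in the formula (1.8), we get
`m_{ij} = Σ_{k ≠ j} w_{ik}({j,k}) / w({j})`»)] -/
theorem IsHittingTimeSolution.PitmanTang2018_eq_1_8 (hP : IsRowStochastic P) (hirr : IsIrreducible P)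
    {h : X → X → ℝ} (hh : IsHittingTimeSolution P h) (a z : X) :
    h a z = (∑ x ∈ univ.erase z, forestWeightTo (fun x y => P x y) {x, z} a x) /
      forestWeight (fun x y => P x y) {z} := by
  obtain ⟨G, hG⟩ := exists_isGreenSolution hP hirr z
  rw [hG.hitting_eq_sum hP hirr hh a, ← add_sum_erase _ _ (mem_univ z), hG.col_target, zero_add,
    sum_div]
  exact sum_congr rfl fun x hx => hG.PitmanTang2018_green hP hirr a (ne_of_mem_erase hx)

end Green

/-! ### §4 The harmonic tree formula (1.9) -/

section Harmonic

variable {P : Matrix X X ℝ} {R : Finset X} {r : X}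

/-- The candidate `h(i) = w_{ir}(R) / w(R)` solves the Dirichlet problem `h = Ph` off `R`, `h = 1_{r}`
on `R`, for ANY kernel with unit row sums and `w(R) ≠ 0` (harmonicity = the identity (2.9)).
[cite: PitmanTang2018, eq. (1.9) and its proof in §2 («it only remains to check that it is
**P**-harmonic on `S ∖ R`»)] -/
theorem isHarmonicExtension_forestWeightTo (hP : ∀ x, ∑ y, P x y = 1) (hr : r ∈ R)
    (hw : forestWeight (fun x y => P x y) R ≠ 0) :
    IsHarmonicExtension P (↑R : Set X) (fun x => if x = r then 1 else 0)
      fun i => forestWeightTo (fun x y => P x y) R i r / forestWeight (fun x y => P x y) R := by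
  refine ⟨fun i hi => ?_, fun i hi => ?_⟩
  · -- boundary values: a root leads only to itself
    show forestWeightTo (fun x y => P x y) R i r / forestWeight (fun x y => P x y) R =
      if i = r then 1 else 0
    rw [forestWeightTo_of_mem_roots _ R (mem_coe.1 hi)]
    by_cases hir : i = r
    · rw [if_pos hir.symm, if_pos hir, div_self hw]
    · rw [if_neg (Ne.symm hir), if_neg hir, zero_div]
  · -- harmonicity off `R`: (2.9) plus the diagonal term on both sides
    show forestWeightTo (fun x y => P x y) R i r / forestWeight (fun x y => P x y) R =
      ∑ y, P i y * (forestWeightTo (fun x y => P x y) R y r / forestWeight (fun x y => P x y) R)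
    have hiR : i ∉ R := fun h => hi (mem_coe.2 h)
    have hkey := outWeight_mul_forestWeightTo (fun x y => P x y) hiR hr
    simp_rw [mul_div_assoc', ← sum_div]
    congr 1
    calc forestWeightTo (fun x y => P x y) R i r
        = (∑ k, P i k) * forestWeightTo (fun x y => P x y) R i r := by rw [hP i, one_mul]
      _ = P i i * forestWeightTo (fun x y => P x y) R i r +
            ∑ k ∈ univ.erase i, P i k * forestWeightTo (fun x y => P x y) R k r := by
          rw [← add_sum_erase _ _ (mem_univ i), add_mul]
          exact congrArg _ hkey
      _ = ∑ y, P i y * forestWeightTo (fun x y => P x y) R y r :=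
          add_sum_erase _ (fun y => P i y * forestWeightTo (fun x y => P x y) R y r) (mem_univ i)

/-- **The harmonic tree formula (1.9)**: on an irreducible chain, the hitting distribution of `R` — the
tree's harmonic extension `h` of the boundary datum `1_{r}` off `R` («the unique function `h` such
that `h(i) = (Ph)(i)` for all `i ∈ S ∖ R` with the boundary condition `h(i) = 1(i = r)`») — is
`h(i) = P_i(X_{T_R} = r) = w_{ir}(R) / w(R)`. [cite: PitmanTang2018, eq. (1.9) (harmonic tree formula)]
[cite: LevinPeres2017, §9.2 Prop. 9.1 (uniqueness of the harmonic extension)] -/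
theorem IsHarmonicExtension.PitmanTang2018_harmonic (hP : IsRowStochastic P) (hirr : IsIrreducible P)
    (hr : r ∈ R) {h : X → ℝ}
    (hh : IsHarmonicExtension P (↑R : Set X) (fun x => if x = r then 1 else 0) h) (i : X) :
    h i = forestWeightTo (fun x y => P x y) R i r / forestWeight (fun x y => P x y) R := by
  have hw : forestWeight (fun x y => P x y) R ≠ 0 := (forestWeight_pos hP hirr ⟨r, hr⟩).ne'
  rw [LevinPeres2017_prop_9_1_unique hP hirr (mem_coe.2 hr) hh
    (isHarmonicExtension_forestWeightTo hP.2 hr hw)]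

/-- The hitting distribution is a probability distribution on `R`: `Σ_{r ∈ R} w_{ir}(R) / w(R) = 1`.
[cite: PitmanTang2018, eq. (1.9) (`P_i(X_{T_R} = j)`, `j ∈ R`)] -/
theorem sum_forestWeightTo_div (P : X → X → ℝ) (hw : forestWeight P R ≠ 0) (i : X) :
    ∑ r ∈ R, forestWeightTo P R i r / forestWeight P R = 1 := by
  rw [← sum_div, sum_forestWeightTo, div_self hw]

end Harmonic

end Literature.Probability.MarkovChains
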